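import Summits.AtomisticToContinuum.BoseEinsteinCondensation.Theorems.SoloInformedGroundStateDoor
import Literature.MathematicalPhysics.QuantumManyBody.BoseGasDiluteEnergyFloor

/-!
# The condensate number is the minimum of `λ_max(γ_Ψ)` over the ground states — unconditionally

Conjunct `BoseEinsteinCondensation` of `AtomisticToContinuum` — statement audit, part 3 of the
ground-state door (soloist report `paper/sharpest.md` §1, §7; answer to the cross-family referee's
verdict on parts 1–2, `solo-ref/VERDICT-bec-door.md` §4.2–4.3). Parts 1–2
(`SoloInformedOccupationSeminorm.lean`, `SoloInformedGroundStateDoor.lean`) identified the audited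
minimising-sequence surrogate `condensateNumber v N L` with `λ_max(γ_{Ψ₀})` under the hypothesis
that the ground state is NONDEGENERATE (`HasUniqueGroundState`) — a hypothesis not landed for any
`v`, false off the thermodynamic regime for hard cores, and not needed. This file removes it:

* `SoloInformed.exists_slack_exists_isGroundState_sq_dist_le` — **near-minimisers are close to the
  set of ground states**: if `E₀(N, L) < ∞` then for every `ε > 0` there is a slack `δ > 0` such that
  every Dirichlet trial state with `⟨Ψ, H_N Ψ⟩ ≤ E₀ + δ` is within `ε` in `L²` of SOME ground state
  (a normalised minimiser of the closed form, `IsGroundState`). Same compactness proof as part 2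
  (Rellich for trial states with bounded kinetic energy, `BoxFace.exists_subseq_tendsto_of_trialStates`
  [Evans2010, §5.7 Thm 1]; lower semicontinuity built into the closed form,
  `IsGroundState.of_tendstoL2` [Kato1966, VI Thm 1.16]; symmetrisation and Dirichlet cut-off of the
  limit), with uniqueness nowhere used; in particular ground states EXIST when `E₀ < ∞`
  (`SoloInformed.exists_isGroundState`);
* `SoloInformed.iInf_maxOccupation_le_condensateNumber`,
  `SoloInformed.condensateNumber_eq_iInf_maxOccupation` — for `E₀(N, L) < ∞`,
  **`condensateNumber v N L = ⨅ {λ_max(γ_Ψ) : Ψ a ground state}`** (`≤` is part 1, for every ground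
  state; `≥` by the previous item and the `√N`-Lipschitz continuity of `λ_max^{1/2}` of part 1);
* `SoloInformed.exists_cap_eventually_groundStateEnergy_ne_top` — for a repulsive finite-range `v`
  the boxes `Λ_{(N/ρ)^{1/3}}` have `E₀ < ∞` eventually at every density below the tree's cap
  `ρ₂(v)` of `exists_density_cap_tendsto_e0` [LSSY2005, Ch. 2 (2.2)];
* the doors WITHOUT nondegeneracy: `SoloInformed.hasGroundStateBEC_of_forall_isGroundState`,
  `SoloInformed.hasGroundStateBEC_iff_forall_isGroundState`, and the exact reformulation of the
  conjunct `SoloInformed.boseEinsteinCondensation_iff_groundStates`: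
  **`BoseEinsteinCondensation ↔` for every repulsive finite-range `v` there is `ρ₀ > 0` such that at
  every density `ρ ∈ (0, ρ₀)` some `c > 0` has, for all large `N`, `λ_max(γ_Ψ) ≥ c N` for EVERY ground
  state `Ψ` of `N` bosons in `Λ_{(N/ρ)^{1/3}}`** [LSSY2005, §1.2 (1.17)–(1.19)] — no side condition.

What this is and is not (referee's §4.1, agreed): a faithfulness theorem for the audited Statement —
its input is the Lieb–Seiringer–Yngvason formulation of BEC itself, the open problem; it reduces
nothing. It shows that the conjunct is EXACTLY the textbook statement quantified over all ground
states, so that degenerate ground states (disconnected hard-core configuration spaces) are neither a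
loophole nor an obstruction of the audited definition.

References: [LSSY2005] Lieb–Seiringer–Solovej–Yngvason, *The Mathematics of the Bose Gas and its
Condensation* (2005), §1.2 (1.17)–(1.19), Ch. 2 (2.2); [ReedSimonIV1978] Reed–Simon, *Methods of
Modern Mathematical Physics IV* (1978), §XIII.12; [Evans2010] Evans, *Partial Differential
Equations*, 2nd ed., §5.7 Thm 1; [Kato1966] Kato, *Perturbation Theory*, VI §1.3–1.4, Thm 1.16.
-/

noncomputable section

open MeasureTheory Filter Set
open scoped ENNReal NNReal ComplexConjugate Topology

namespace Summit.AtomisticToContinuum.BoseEinsteinCondensation.Theorems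

open Literature.MathematicalPhysics.QuantumManyBody.BoseGas

variable {n : ℕ}

/-- **Near-minimisers are `L²`-close to the set of ground states.** If `E₀(N, L) < ∞` then for
every `ε > 0` there is a slack `δ > 0` such that every Dirichlet trial state with
`⟨Ψ, H_N Ψ⟩ ≤ E₀ + δ` satisfies `∫ |Ψ - Φ₀|² ≤ ε` for some ground state `Φ₀` (depending on `Ψ`).
Proof by compactness exactly as in `SoloInformed.exists_slack_sq_dist_groundState_le`, without the
uniqueness step: a violating sequence of near-minimisers has bounded kinetic energy, hence (Rellich)
an `L²`- and a.e.-convergent subsequence whose symmetrised, Dirichlet-cut limit is a ground state by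
lower semicontinuity of the closed form — contradiction. [cite: Kato1966, VI §1.4 Thm 1.16] -/
theorem SoloInformed.exists_slack_exists_isGroundState_sq_dist_le {N : ℕ} {v : ℝ → ℝ≥0∞} {L : ℝ}
    (hL : 0 ≤ L) (hE : groundStateEnergy v N L ≠ ⊤) {ε : ℝ≥0∞} (hε : 0 < ε) :
    ∃ δ : ℝ≥0∞, 0 < δ ∧ ∀ Ψ : TrialState N L,
      energy v Ψ ≤ groundStateEnergy v N L + δ →
        ∃ Φ₀ : Config N → ℂ, IsGroundState v L Φ₀ ∧
          ∫⁻ X, (‖Ψ.ψ X - Φ₀ X‖₊ : ℝ≥0∞) ^ 2 ≤ ε := by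
  by_contra hcon
  push Not at hcon
  have hδpos : ∀ m : ℕ, (0 : ℝ≥0∞) < ((m + 1 : ℕ) : ℝ≥0∞)⁻¹ := fun m =>
    ENNReal.inv_pos.2 (ENNReal.natCast_ne_top _)
  choose Φ hΦE hΦfar using fun m : ℕ => hcon _ (hδpos m)
  -- uniform kinetic bound `≤ E₀ + 1`
  have hK : groundStateEnergy v N L + 1 ≠ ⊤ := ENNReal.add_ne_top.2 ⟨hE, ENNReal.one_ne_top⟩
  have hkin : ∀ m, ∫⁻ X, kineticDensity (Φ m).ψ X ≤ groundStateEnergy v N L + 1 := by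
    intro m
    calc ∫⁻ X, kineticDensity (Φ m).ψ X ≤ energy v (Φ m) := by
          unfold energy
          exact lintegral_mono fun X => le_self_add
      _ ≤ groundStateEnergy v N L + ((m + 1 : ℕ) : ℝ≥0∞)⁻¹ := hΦE m
      _ ≤ groundStateEnergy v N L + 1 := by
          gcongr
          exact ENNReal.inv_le_one.2 (Nat.one_le_cast.2 (Nat.le_add_left 1 m))
  -- Rellich: an `L²`- and a.e.-convergent subsequence
  obtain ⟨f, κ, hκ, hf2, hlim, hae⟩ :=
    BoxFace.exists_subseq_tendsto_of_trialStates (N := N) (fun _ => L) (Lbar := L)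
      (fun _ => hL) (fun _ => le_rfl) Φ hK hkin
  -- (1) a measurable version of the limit
  set f₁ : Config N → ℂ := hf2.1.mk f with hf₁
  have hf₁m : Measurable f₁ := hf2.1.stronglyMeasurable_mk.measurable
  have hff₁ : f =ᵐ[volume] f₁ := hf2.1.ae_eq_mk
  -- (2) Dirichlet cut-off: the limit vanishes a.e. off the box anyway
  set f₂ : Config N → ℂ := (boxN N L).indicator f₁ with hf₂
  have hf₂m : Measurable f₂ := hf₁m.indicator (SoloInformed.measurableSet_boxN N L)
  have hf0 : ∀ᵐ X : Config N, X ∉ boxN N L → f X = 0 := by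
    filter_upwards [hae] with X hX hXb
    have h0 : (fun m => (Φ (κ m)).ψ X) = fun _ => 0 := funext fun m => (Φ (κ m)).eq_zero X hXb
    rw [h0] at hX
    exact tendsto_nhds_unique hX tendsto_const_nhds
  have hff₂ : f =ᵐ[volume] f₂ := by
    filter_upwards [hff₁, hf0] with X h1 h0
    by_cases hX : X ∈ boxN N L
    · rw [hf₂, Set.indicator_of_mem hX]
      exact h1
    · rw [hf₂, Set.indicator_of_notMem hX]
      exact h0 hX
  -- (3) symmetrisation
  set g : Config N → ℂ := fun X => ((Fintype.card (Equiv.Perm (Fin N)) : ℂ))⁻¹ *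
      ∑ σ : Equiv.Perm (Fin N), f₂ (X ∘ σ) with hg
  have hgm : Measurable g :=
    measurable_const.mul (Finset.measurable_sum _ fun σ _ =>
      hf₂m.comp (SoloInformed.measurable_comp_perm σ))
  have hg0 : ∀ X, X ∉ boxN N L → g X = 0 := by
    intro X hX
    have h0 : ∀ σ : Equiv.Perm (Fin N), f₂ (X ∘ σ) = 0 := fun σ => by
      rw [hf₂]
      exact Set.indicator_of_notMem
        (fun h => hX ((SoloInformed.comp_perm_mem_boxN_iff σ L X).1 h)) _
    simp only [hg, h0, Finset.sum_const_zero, mul_zero]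
  have hgs : ∀ (τ : Equiv.Perm (Fin N)) (X : Config N), g (X ∘ τ) = g X := by
    intro τ X
    simp only [hg]
    congr 1
    exact Fintype.sum_equiv (Equiv.mulLeft τ) _ _ fun σ => rfl
  -- (4) the symmetrised cut-off version agrees with the limit a.e.
  have hT : ∀ σ : Equiv.Perm (Fin N),
      MeasurePreserving (fun X : Config N => X ∘ σ) volume volume :=
    fun σ => SoloInformed.measurePreserving_comp_perm σ
  have hfσ : ∀ σ : Equiv.Perm (Fin N), (fun X => f (X ∘ σ)) =ᵐ[volume] f := by
    intro σ
    have h1 := (hT σ).quasiMeasurePreserving.ae hae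
    filter_upwards [h1, hae] with X hXσ hX
    have e : (fun m => (Φ (κ m)).ψ (X ∘ σ)) = fun m => (Φ (κ m)).ψ X :=
      funext fun m => (Φ (κ m)).symm σ X
    have hXσ' : Tendsto (fun m => (Φ (κ m)).ψ X) atTop (𝓝 (f (X ∘ σ))) := by
      rw [← e]
      exact hXσ
    exact tendsto_nhds_unique hXσ' hX
  have hf₂σ : ∀ σ : Equiv.Perm (Fin N), (fun X => f₂ (X ∘ σ)) =ᵐ[volume] f₂ := by
    intro σ
    have h1 : (fun X => f₂ (X ∘ σ)) =ᵐ[volume] fun X => f (X ∘ σ) :=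
      (hT σ).quasiMeasurePreserving.ae_eq hff₂.symm
    exact (h1.trans (hfσ σ)).trans hff₂
  have hgf : g =ᵐ[volume] f := by
    have hall : ∀ᵐ X : Config N, ∀ σ : Equiv.Perm (Fin N), f₂ (X ∘ σ) = f₂ X :=
      ae_all_iff.2 fun σ => hf₂σ σ
    filter_upwards [hall, hff₂] with X hX hX2
    simp only [hg, hX, Finset.sum_const, Finset.card_univ, nsmul_eq_mul]
    rw [← mul_assoc, inv_mul_cancel₀ (Nat.cast_ne_zero.2 Fintype.card_ne_zero), one_mul, hX2]
  -- (5) `L²` convergence of the subsequence to `g`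
  have hT2 : Tendsto (fun m => ∫⁻ X, (‖(Φ (κ m)).ψ X - g X‖₊ : ℝ≥0∞) ^ 2) atTop (𝓝 0) := by
    have h1 : ∀ m, ∫⁻ X, (‖(Φ (κ m)).ψ X - g X‖₊ : ℝ≥0∞) ^ 2 =
        (eLpNorm ((Φ (κ m)).ψ - f) 2 volume) ^ 2 := by
      intro m
      rw [eLpNorm_two_eq_rpow, ENNReal.rpow_half_sq]
      refine lintegral_congr_ae (hgf.mono fun X hX => ?_)
      simp only [Pi.sub_apply, hX]
    simp_rw [h1]
    have := ((ENNReal.continuous_pow 2).tendsto (0 : ℝ≥0∞)).comp hlim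
    rwa [zero_pow two_ne_zero] at this
  have hT2' : TendstoL2 (fun m => Φ (κ m)) g := hT2
  -- (6) the energies along the subsequence have `liminf ≤ E₀`
  have hδlim : Tendsto (fun m => ((κ m + 1 : ℕ) : ℝ≥0∞)⁻¹) atTop (𝓝 0) :=
    ENNReal.tendsto_inv_nat_nhds_zero.comp ((tendsto_add_atTop_nat 1).comp hκ.tendsto_atTop)
  have hEn : liminf (fun m => energy v (Φ (κ m))) atTop ≤ groundStateEnergy v N L := by
    have hup : Tendsto (fun m => groundStateEnergy v N L + ((κ m + 1 : ℕ) : ℝ≥0∞)⁻¹) atTop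
        (𝓝 (groundStateEnergy v N L)) := by
      have := (tendsto_const_nhds (x := groundStateEnergy v N L)).add hδlim
      rwa [add_zero] at this
    calc liminf (fun m => energy v (Φ (κ m))) atTop
        ≤ liminf (fun m => groundStateEnergy v N L + ((κ m + 1 : ℕ) : ℝ≥0∞)⁻¹) atTop :=
          liminf_le_liminf (Eventually.of_forall fun m => hΦE (κ m))
      _ = groundStateEnergy v N L := hup.liminf_eq
  -- (7) `g` is a ground state, and the subsequence is eventually `ε`-close to it: contradiction
  have hg_gs : IsGroundState v L g := IsGroundState.of_tendstoL2 hgm hg0 hgs hE hT2' hEn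
  obtain ⟨m, hm⟩ := (hT2.eventually (ge_mem_nhds hε)).exists
  exact absurd hm (not_le.2 (hΦfar (κ m) g hg_gs))

/-- **Ground states exist when the energy is finite** (existence of a minimiser of the closed
Dirichlet form by Rellich compactness and lower semicontinuity).
[cite: ReedSimonIV1978, §XIII.12 p. 201] -/
theorem SoloInformed.exists_isGroundState {N : ℕ} {v : ℝ → ℝ≥0∞} {L : ℝ} (hL : 0 ≤ L)
    (hE : groundStateEnergy v N L ≠ ⊤) : ∃ Φ₀ : Config N → ℂ, IsGroundState v L Φ₀ := by
  obtain ⟨δ, hδ, h⟩ :=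
    SoloInformed.exists_slack_exists_isGroundState_sq_dist_le hL hE zero_lt_one
  obtain ⟨Ψ, hΨ⟩ : ∃ Ψ : TrialState N L, energy v Ψ ≤ groundStateEnergy v N L + δ := by
    have hlt : groundStateEnergy v N L < groundStateEnergy v N L + δ :=
      ENNReal.lt_add_right hE hδ.ne'
    obtain ⟨Ψ, hΨ⟩ := iInf_lt_iff.1 hlt
    exact ⟨Ψ, hΨ.le⟩
  obtain ⟨Φ₀, hΦ₀, -⟩ := h Ψ hΨ
  exact ⟨Φ₀, hΦ₀⟩

/-- **`⨅_{ground states} λ_max(γ_Ψ) ≤ condensateNumber`** for `E₀(N, L) < ∞`: every `δ`-near-minimiser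
is `L²`-close to some ground state (`SoloInformed.exists_slack_exists_isGroundState_sq_dist_le`)
and `λ_max^{1/2}` is `√N`-Lipschitz in `L²` (part 1), so
`((⨅ λ_max)^{1/2} - (Nε)^{1/2})² ≤ condensateNumber` for every `ε > 0`. No nondegeneracy.
[cite: LSSY2005, §1.2 (1.17)–(1.19)] -/
theorem SoloInformed.iInf_maxOccupation_le_condensateNumber {v : ℝ → ℝ≥0∞} {L : ℝ}
    (hL : 0 ≤ L) (hE : groundStateEnergy v (n + 1) L ≠ ⊤) :
    (⨅ (Φ₀ : Config (n + 1) → ℂ) (_ : IsGroundState v L Φ₀), maxOccupation (n + 1) Φ₀) ≤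
      condensateNumber v (n + 1) L := by
  have hN : (n + 1 : ℝ≥0∞) ≠ ⊤ := ENNReal.add_ne_top.2 ⟨ENNReal.natCast_ne_top n, ENNReal.one_ne_top⟩
  set A := ⨅ (Φ₀ : Config (n + 1) → ℂ) (_ : IsGroundState v L Φ₀), maxOccupation (n + 1) Φ₀
    with hA
  have hhalf : (0 : ℝ) ≤ 1 / 2 := by norm_num
  -- for every `ε > 0`
  have key : ∀ ε : ℝ≥0∞, 0 < ε →
      (A ^ (1 / 2 : ℝ) - ((n + 1 : ℝ≥0∞) * ε) ^ (1 / 2 : ℝ)) ^ 2 ≤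
        condensateNumber v (n + 1) L := by
    intro ε hε
    obtain ⟨δ, hδ, hnear⟩ :=
      SoloInformed.exists_slack_exists_isGroundState_sq_dist_le hL hE hε
    refine le_condensateNumber v hδ fun Ψ hΨ => ?_
    obtain ⟨Φ₀, hΦ₀, hdΨ⟩ := hnear Ψ hΨ
    have hΦ₀m : Measurable Φ₀ := hΦ₀.measurable
    have hΦ₀1 : ∫⁻ X, (‖Φ₀ X‖₊ : ℝ≥0∞) ^ 2 = 1 := hΦ₀.norm_eq
    have h := SoloInformed.maxOccupation_rpow_half_le_add hΦ₀m Ψ.contDiff.continuous.measurable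
      (by rw [hΦ₀1]; exact ENNReal.one_ne_top) (by rw [Ψ.norm_eq]; exact ENNReal.one_ne_top)
    have hdist : ∫⁻ X, (‖Φ₀ X - Ψ.ψ X‖₊ : ℝ≥0∞) ^ 2 ≤ ε := by
      refine le_of_eq_of_le (lintegral_congr fun X => ?_) hdΨ
      rw [← nnnorm_neg, neg_sub]
    have hb : ((n + 1 : ℝ≥0∞) * ∫⁻ X, (‖Φ₀ X - Ψ.ψ X‖₊ : ℝ≥0∞) ^ 2) ^ (1 / 2 : ℝ) ≤
        ((n + 1 : ℝ≥0∞) * ε) ^ (1 / 2 : ℝ) :=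
      ENNReal.rpow_le_rpow (mul_le_mul_right hdist _) hhalf
    have hAΦ : A ^ (1 / 2 : ℝ) ≤ maxOccupation (n + 1) Φ₀ ^ (1 / 2 : ℝ) :=
      ENNReal.rpow_le_rpow (iInf₂_le Φ₀ hΦ₀) hhalf
    have hsub : A ^ (1 / 2 : ℝ) - ((n + 1 : ℝ≥0∞) * ε) ^ (1 / 2 : ℝ) ≤
        maxOccupation (n + 1) Ψ.ψ ^ (1 / 2 : ℝ) :=
      ((tsub_le_tsub_left hb _).trans (tsub_le_tsub_right hAΦ _)).trans (tsub_le_iff_right.2 h)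
    calc (A ^ (1 / 2 : ℝ) - ((n + 1 : ℝ≥0∞) * ε) ^ (1 / 2 : ℝ)) ^ 2
        ≤ (maxOccupation (n + 1) Ψ.ψ ^ (1 / 2 : ℝ)) ^ 2 := by gcongr
      _ = maxOccupation (n + 1) Ψ.ψ := ENNReal.rpow_half_sq _
  -- let `ε = 1/k → 0`
  have h1 : Tendsto (fun k : ℕ => (n + 1 : ℝ≥0∞) * (k : ℝ≥0∞)⁻¹) atTop (𝓝 0) := by
    have := ENNReal.Tendsto.const_mul ENNReal.tendsto_inv_nat_nhds_zero (Or.inr hN)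
    rwa [mul_zero] at this
  have h2 : Tendsto (fun k : ℕ => ((n + 1 : ℝ≥0∞) * (k : ℝ≥0∞)⁻¹) ^ (1 / 2 : ℝ)) atTop (𝓝 0) := by
    have := ((ENNReal.continuous_rpow_const (y := (1 / 2 : ℝ))).tendsto (0 : ℝ≥0∞)).comp h1
    rwa [ENNReal.zero_rpow_of_pos (by norm_num : (0 : ℝ) < 1 / 2)] at this
  have h3 : Tendsto (fun k : ℕ => A ^ (1 / 2 : ℝ) - ((n + 1 : ℝ≥0∞) * (k : ℝ≥0∞)⁻¹) ^ (1 / 2 : ℝ))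
      atTop (𝓝 (A ^ (1 / 2 : ℝ))) := by
    have := ENNReal.Tendsto.sub (tendsto_const_nhds (x := A ^ (1 / 2 : ℝ))) h2
      (Or.inr ENNReal.zero_ne_top)
    rwa [tsub_zero] at this
  have h4 := ((ENNReal.continuous_pow 2).tendsto _).comp h3
  rw [ENNReal.rpow_half_sq] at h4
  exact le_of_tendsto h4 (Eventually.of_forall fun k =>
    key _ (ENNReal.inv_pos.2 (ENNReal.natCast_ne_top k)))

/-- **The condensate number is the minimum of `λ_max(γ_Ψ)` over the ground states**, for every box
with `E₀(N, L) < ∞`: `condensateNumber v N L = ⨅ {maxOccupation N Ψ : IsGroundState v L Ψ}` — the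
faithfulness of the audited minimising-sequence definition WITHOUT any nondegeneracy hypothesis
(with a nondegenerate ground state the infimum is `λ_max(γ_{Ψ₀})`, part 2).
[cite: LSSY2005, §1.2 (1.17)–(1.19)] -/
theorem SoloInformed.condensateNumber_eq_iInf_maxOccupation {v : ℝ → ℝ≥0∞} {L : ℝ}
    (hL : 0 ≤ L) (hE : groundStateEnergy v (n + 1) L ≠ ⊤) :
    condensateNumber v (n + 1) L =
      ⨅ (Φ₀ : Config (n + 1) → ℂ) (_ : IsGroundState v L Φ₀), maxOccupation (n + 1) Φ₀ :=
  le_antisymm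
    (le_iInf₂ fun _ hΦ₀ => SoloInformed.condensateNumber_le_maxOccupation_of_isGroundState hΦ₀)
    (SoloInformed.iInf_maxOccupation_le_condensateNumber hL hE)

/-! ### Finite energy along the thermodynamic boxes -/

/-- **The thermodynamic boxes have finite ground-state energy, eventually.** For a repulsive
finite-range `v` and every density `0 < ρ < ρ₂(v)` (the tree's cap of `exists_density_cap_tendsto_e0`,
below which `E₀(N, L_N)/N → e₀(ρ) < ∞`), eventually `E₀(N, (N/ρ)^{1/3}) < ∞`.
[cite: LSSY2005, Ch. 2 eq. (2.2)] -/
theorem SoloInformed.exists_cap_eventually_groundStateEnergy_ne_top (v : ℝ → ℝ≥0∞)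
    (hv : IsRepulsiveFiniteRange v) :
    ∃ ρ₂ : ℝ, 0 < ρ₂ ∧ ∀ ρ : ℝ, 0 < ρ → ρ < ρ₂ →
      ∀ᶠ N : ℕ in atTop, groundStateEnergy v N (sideLength ρ N) ≠ ⊤ := by
  obtain ⟨ρ₂, hρ₂, h⟩ := exists_density_cap_tendsto_e0 v hv
  refine ⟨ρ₂, hρ₂, fun ρ h0 h1 => ?_⟩
  obtain ⟨he, hT, -⟩ := h ρ h0 h1
  have hlt : e0 v ρ < e0 v ρ + 1 := ENNReal.lt_add_right he one_ne_zero
  filter_upwards [(tendsto_order.1 hT).2 _ hlt, eventually_ge_atTop 1] with N hN hN1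
  have hNne : (N : ℝ≥0∞) ≠ 0 := Nat.cast_ne_zero.2 (by omega)
  have hfin : energyPerParticleDirichlet v ρ N ≠ ⊤ :=
    ne_top_of_lt (hN.trans_le le_top)
  have heq : groundStateEnergy v N (sideLength ρ N) =
      energyPerParticleDirichlet v ρ N * N := by
    unfold energyPerParticleDirichlet
    rw [ENNReal.div_mul_cancel hNne (ENNReal.natCast_ne_top N)]
  rw [heq]
  exact ENNReal.mul_ne_top hfin (ENNReal.natCast_ne_top N)

/-! ### The doors without nondegeneracy -/

/-- **Ground-state door, unconditional form.** If the thermodynamic boxes have finite energy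
eventually and EVERY ground state `Ψ` of `N` bosons in `Λ_{(N/ρ)^{1/3}}` has `λ_max(γ_Ψ) ≥ c N` for all
large `N`, then `HasGroundStateBEC v ρ`. [cite: LSSY2005, §1.2 (1.19)] -/
theorem SoloInformed.hasGroundStateBEC_of_forall_isGroundState (v : ℝ → ℝ≥0∞) {ρ : ℝ}
    (hρ : 0 < ρ) {c : ℝ} (hc : 0 < c)
    (hE : ∀ᶠ N : ℕ in atTop, groundStateEnergy v N (sideLength ρ N) ≠ ⊤)
    (hocc : ∀ᶠ N : ℕ in atTop, ∀ Ψ : Config N → ℂ, IsGroundState v (sideLength ρ N) Ψ →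
      ENNReal.ofReal (c * N) ≤ maxOccupation N Ψ) :
    HasGroundStateBEC v ρ := by
  refine ⟨c, hc, ?_⟩
  filter_upwards [hE, hocc, eventually_ge_atTop 1] with N hEN hoccN hN1
  obtain ⟨m, rfl⟩ : ∃ m, N = m + 1 := ⟨N - 1, (Nat.sub_add_cancel hN1).symm⟩
  rw [SoloInformed.condensateNumber_eq_iInf_maxOccupation (sideLength_nonneg hρ.le _) hEN]
  exact le_iInf₂ fun Ψ hΨ => hoccN Ψ hΨ

/-- **`HasGroundStateBEC v ρ ⟺` uniform `λ_max ≥ cN` for all ground states**, at every density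
below the finite-energy cap `ρ₂(v)` of a repulsive finite-range `v`.
[cite: LSSY2005, §1.2 (1.17)–(1.19)] -/
theorem SoloInformed.hasGroundStateBEC_iff_forall_isGroundState (v : ℝ → ℝ≥0∞)
    (hv : IsRepulsiveFiniteRange v) :
    ∃ ρ₂ : ℝ, 0 < ρ₂ ∧ ∀ ρ : ℝ, 0 < ρ → ρ < ρ₂ →
      (HasGroundStateBEC v ρ ↔
        ∃ c : ℝ, 0 < c ∧ ∀ᶠ N : ℕ in atTop, ∀ Ψ : Config N → ℂ,
          IsGroundState v (sideLength ρ N) Ψ → ENNReal.ofReal (c * N) ≤ maxOccupation N Ψ) := by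
  obtain ⟨ρ₂, hρ₂, h⟩ := SoloInformed.exists_cap_eventually_groundStateEnergy_ne_top v hv
  refine ⟨ρ₂, hρ₂, fun ρ h0 h1 => ⟨SoloInformed.eventually_le_maxOccupation_of_hasGroundStateBEC,
    fun ⟨c, hc, hocc⟩ => ?_⟩⟩
  exact SoloInformed.hasGroundStateBEC_of_forall_isGroundState v h0 hc (h ρ h0 h1) hocc

/-- **The conjunct, reformulated exactly.** `BoseEinsteinCondensation` holds if and only if for
every repulsive finite-range `v` there is `ρ₀ > 0` such that at every density `ρ ∈ (0, ρ₀)` some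
`c > 0` has, for all large `N`, `λ_max(γ_Ψ) ≥ c N` for every ground state `Ψ` (normalised minimiser
of the closed Dirichlet form, Bose sector) of `N` bosons in `Λ_{(N/ρ)^{1/3}}` — the
Lieb–Seiringer–Yngvason formulation, with no nondegeneracy or finiteness side condition.
[cite: LSSY2005, §1.2 (1.17)–(1.19)] -/
theorem SoloInformed.boseEinsteinCondensation_iff_groundStates :
    _root_.BoseEinsteinCondensation ↔
      ∀ v : ℝ → ℝ≥0∞, IsRepulsiveFiniteRange v →
        ∃ ρ₀ : ℝ, 0 < ρ₀ ∧ ∀ ρ : ℝ, 0 < ρ → ρ < ρ₀ →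
          ∃ c : ℝ, 0 < c ∧ ∀ᶠ N : ℕ in atTop, ∀ Ψ : Config N → ℂ,
            IsGroundState v (sideLength ρ N) Ψ → ENNReal.ofReal (c * N) ≤ maxOccupation N Ψ := by
  constructor
  · intro H v hv
    obtain ⟨ρ₀, hρ₀, hρ⟩ := H v hv
    exact ⟨ρ₀, hρ₀, fun ρ h0 h1 =>
      SoloInformed.eventually_le_maxOccupation_of_hasGroundStateBEC (hρ ρ h0 h1)⟩
  · intro H v hv
    obtain ⟨ρ₀, hρ₀, hρ⟩ := H v hv
    obtain ⟨ρ₂, hρ₂, h₂⟩ := SoloInformed.exists_cap_eventually_groundStateEnergy_ne_top v hv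
    refine ⟨min ρ₀ ρ₂, lt_min hρ₀ hρ₂, fun ρ h0 h1 => ?_⟩
    obtain ⟨c, hc, hocc⟩ := hρ ρ h0 (h1.trans_le (min_le_left _ _))
    exact SoloInformed.hasGroundStateBEC_of_forall_isGroundState v h0 hc
      (h₂ ρ h0 (h1.trans_le (min_le_right _ _))) hocc

end Summit.AtomisticToContinuum.BoseEinsteinCondensation.Theorems

end
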